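import Summits.HodgeConjecture.HodgeConjecture.Theses.DworkReflectionQuotients

/-!
# Assembly item of route `DworkReflectionQuotients` (stmt-HodgeConjecture-19675)

Route `route-HodgeConjecture-DworkReflectionQuotients` (cell `hodge-nonav`, rung F-H1 — never summit
credit), item `stmt-HodgeConjecture-19675` (`Assembly`, rank 1). The item's statement
`ReflectionQuotientDescent → FlatClassesSpannedByReflectionInvariants → GenericHodgeClassesFlat →
DworkOtherCodimensions → DworkPrymHodge.DworkSexticHodge` is, curried, the route file's own
kernel-checked deciding theorem `Theses.DworkReflectionQuotients.closes` (countable exceptional set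
`S ∪ μ₆`; codimension `p = 2` by `Submodule.span_le` from the two cruxes and the generic-flatness
support item; `p ≠ 2` by `DworkOtherCodimensions`). UNCONDITIONAL as an implication (it credits
nothing about its four hypotheses: crux K1 `ReflectionQuotientDescent` = stmt-20240 and the support
item `GenericHodgeClassesFlat` = stmt-20243 are open at the time of landing; K2 and
`DworkOtherCodimensions` are proved). A candidate with the same one-line content was attached by the
refuter (evidence `Proof19675.lean`, critic-2 g9). Prover seat `hodge-nonav-20241-p1` (g7), 2026-08-27.

## References

* N. M. Katz, *Another look at the Dwork family*, Progr. Math. 270 (2009), §3. [Katz2009]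
* A. Conte, J. P. Murre, *The Hodge conjecture for fourfolds admitting a covering by rational
  curves*, Math. Ann. 238 (1978). [ConteMurre1978]
-/

namespace Summit.HodgeConjecture.HodgeConjecture.Theorems

/-- **Item stmt-HodgeConjecture-19675 (`Assembly`), proved.** The four route items imply the rung
leaf `DworkSexticHodge` (HC for the very general Dwork sextic fourfold): this is the route file's
deciding theorem `closes`, curried. [cite: Katz2009, §3] -/
theorem dworkReflectionQuotients_assembly_proof :
    Summit.HodgeConjecture.HodgeConjecture.Theses.DworkReflectionQuotients.Assembly :=
  fun h1 h2 h3 h4 =>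
    Summit.HodgeConjecture.HodgeConjecture.Theses.DworkReflectionQuotients.closes h1 h2 h3 h4

end Summit.HodgeConjecture.HodgeConjecture.Theorems
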